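import Literature.AlgebraicGeometry.PlaneCurves.HessePencilHarmonicMembers
import Literature.AlgebraicGeometry.PlaneCurves.HessePencilInvariants
import HarnessLib

/-!
# The special orbits of the tetrahedral group: the four equianharmonic and the six harmonic
# parameters of the Hesse pencil (Bonifant–Milnor §3; Artebani–Dolgachev §2, §4)

Topic `Literature/AlgebraicGeometry/PlaneCurves`, namespace
`Literature.AlgebraicGeometry.PlaneCurves`.
Lane `lit-hodgefound`, seat `lit-hodgefound-p37`, row g19-#6; a one-file sequel of the seat's
`HessePencilHarmonicMembers` (g17: for `3 ≠ 0`, `μ³ ≠ 1`: `j(W_μ) = 0 ↔ μ(μ³ + 8) = 0` and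
`j(W_μ) = 1728 ↔ μ⁶ − 20μ³ − 8 = 0`), `HessePencilInvariants` (g18:
`Φ₁₂ = H₀·H_{−2}·H_{−2ω}·H_{−2ω²}`, `μ(μ³ + 8) = μ(μ + 2)(μ + 2ω)(μ + 2ω²)`, and `Φ₁₈` vanishes
pointwise on the harmonic members) and
`HessePencilTetrahedralOrbits` (g19-#1: the generic fibres of `k ↦ J(k)` are the orbits of the
twelve-element tetrahedral group).  It WRITES OUT the two exceptional fibres — the printed lists of
the equianharmonic and of the harmonic parameters — and COUNTS them (`4` and `6`), and factors
`Φ₁₈` into the six harmonic members.  Everything here is PROVED; no definition, no named fact.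

Sources followed, VERBATIM.  A. Bonifant, J. Milnor, *On real and complex cubic curves*,
L'Enseignement Math. 63 (2017) 21–61, §3 [journal scan held as
`paper:galaxy-pdf-4605502542324595860`: p0103 L19, p0116 L5, p0120 L5–L10] (their Hesse curve
`𝒞(k)` is `x³ + y³ + z³ = 3kxyz`, EXACTLY the lane's `H_k = X³ + Y³ + Z³ − 3kXYZ`; their `J` is
`j/1728`, `γ = e^{2πi/3}`):

> (14) `J(𝒞(k)) = (k(k³ + 8)/(4(k³ − 1)))³` […] (However, an irrational value of `k` may
> correspond to a rational `J`. For example `k = 1 ± √3` yields `J = 1`.) […]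
> [Figure 11] Note that every line `J = constant` intersects the graph in exactly two points. As
> examples, for `J = 0` we have `k = 0` or `k = −2`, while for `J = 1` we have `k = 1 ± √3`. […]
> [proof of Theorem 3.12] It is not hard to check that the orbit of `1 + √3` consists of the
> following six points, each counted twice since `1 + √3` is a fixed point of `η`:
> `1 + √3, (1 + √3)γ, (1 + √3)γ̄, 1 − √3, (1 − √3)γ, (1 − √3)γ̄`.
> Since `(1 + √3)(1 − √3) = −2` and `γγ̄ = 1`, the product `∏_μ μ(1 + √3)` is equal to
> `(−2)⁶ = 64`. Comparing this with `J(1 + √3) = 1`, the conclusion follows.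

M. Artebani, I. Dolgachev, *The Hesse pencil of plane cubic curves*, Enseign. Math. 55 (2009)
235–273 [held `paper:arxiv-math_0611590`: p0005 L2–L12, p0008 L23 and L74] (their `E_λ` is
`x³ + y³ + z³ + λxyz`, `λ = −3μ`; `ε = ω`):

> `A(t₀, t₁) = 12u₁(u₀³ − u₁³)`, `B(t₀, t₁) = 2(u₀⁶ − 20u₀³u₁³ − 8u₁⁶)` […] The zeroes of the
> binary form `A(t₀, t₁)` define the curves from the Hesse pencil which admit an automorphism of
> order 6 with a fixed point (equianharmonic cubics). For example, the Fermat curve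
> `E₀ : x³ + y³ + z³ = 0` is one of them. The zeroes of the binary form `B(t₀, t₁)` define the
> curves from the Hesse pencil which admit an automorphism of order 4 with a fixed point (harmonic
> cubics). […] §4: its subgroup `A₄` acts as a tetrahedral group with orbits of cardinalities
> `12, 6, 4, 4`. […] `Φ₁₈ = (x³ + y³ + z³)⁶ − 540x³y³z³(x³ + y³ + z³)³ − 5832x⁶y⁶z⁶.` The curve
> `Φ₁₈ = 0` is the union of the six harmonic cubics in the pencil.

## Dictionary

* `ω ∈ K` with `ω² + ω + 1 = 0` is `γ`/`ε`; `s ∈ K` with `s² = 3` is `√3` (a hypothesis: over a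
  field without `√3` the harmonic sextic has no root of the printed form);
  `𝐣[k] := k³(k³ + 8)³/(k³ − 1)³ = 64·J(𝒞(k)) = j(W_k)/27`
  (`HessePencilWeierstrassForm.hesse_weierstrass_j`),
  a local notation for the printed rational function — so "`J = 0`" is `𝐣 = 0` and "`J = 1`" is
  `𝐣 = 64`; `𝐇[μ] = X³ + Y³ + Z³ − 3μXYZ`; `Φ₁₈` as printed; `𝐖[μ]` the Weierstrass model of
  `HessePencilWeierstrassForm`.  All local notations, no definitions.
* "equianharmonic" `:=` `k(k³ + 8) = 0` (`c₄(W_k) = 0`, `HessePencilHarmonicMembers`); "harmonic"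
  `:=` `k⁶ − 20k³ − 8 = 0` (`c₆(W_k) = 0`).

## What is proved

* §1 **the four equianharmonic parameters** ("for `J = 0` we have `k = 0` or `k = −2`" over `ℝ`;
  "the four equianharmonic members"): `hesseJ_eq_zero_iff` (`𝐣[k] = 0 ↔ k(k³ + 8) = 0` for
  `k³ ≠ 1`), `hesse_equianharmonic_iff` (`k(k³ + 8) = 0 ↔ k ∈ {0, −2, −2ω, −2ω²}`),
  `hesse_equianharmonic_pow_three_ne_one` (they are smooth, `3 ≠ 0`), `hesse_equianharmonic_nodup`
  / `hesse_equianharmonic_ncard` (**exactly four**, `2, 3 ≠ 0`), and the fibre statement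
  `hesseJ_fibre_zero_eq` / `hesseJ_fibre_zero_ncard`: `{l : l³ ≠ 1, J(l) = 0} = {0, −2, −2ω, −2ω²}`
  has four elements — an orbit of cardinality `4`.
* §2 **the six harmonic parameters** ("for `J = 1` we have `k = 1 ± √3`"; "the orbit of `1 + √3`
  consists of the following six points"): `hesseJ_eq_sixty_four_iff`
  (`𝐣[k] = 64 ↔ k⁶ − 20k³ − 8 = 0`,
  via the printed "each counted twice": `k³(k³ + 8)³ − 64(k³ − 1)³ = (k⁶ − 20k³ − 8)²`),
  `hesse_harmonic_eq_prod_six` (`k⁶ − 20k³ − 8 = ∏ (k − ω^b(1 ± s))`), `hesse_harmonic_iff`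
  (`↔ k ∈ {1 + s, 1 − s, ω(1 + s), ω(1 − s), ω²(1 + s), ω²(1 − s)}`),
  `hesse_harmonic_pow_three_ne_one`, `hesse_harmonic_nodup` / `hesse_harmonic_ncard` (**exactly
  six**, `2, 3 ≠ 0`), `hesse_one_add_sqrt_three_harmonic` ("`k = 1 ± √3` yields `J = 1`"), and the
  fibre statements `hesseJ_fibre_sixty_four_eq` / `hesseJ_fibre_sixty_four_ncard` /
  `hesseJ_fibre_one_add_sqrt_three` (B–M's sentence: the smooth parameters with `J = J(1 + √3)`
  are exactly the six printed points) — an orbit of cardinality `6`.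
* §3 **"The curve `Φ₁₈ = 0` is the union of the six harmonic cubics in the pencil"** as an
  IDENTITY of forms: `phi18_eq_prod` —
  `Φ₁₈ = H_{1+s}·H_{1−s}·H_{ω(1+s)}·H_{ω(1−s)}·H_{ω²(1+s)}·H_{ω²(1−s)}`
  in `K[X, Y, Z]` (the tree's `HessePencilInvariants.phi18_eval_of_mem` is the pointwise form; the
  companion `Φ₁₂ = H₀·H_{−2}·H_{−2ω}·H_{−2ω²}` is `HessePencilInvariants.phi12_eq_prod`).
* §4 **bridge to Mathlib's `j`**: `hesse_weierstrass_j_eq_zero_iff_mem`,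
  `hesse_weierstrass_j_eq_1728_iff_mem` — for `3 ≠ 0`, `μ³ ≠ 1`: `j(W_μ) = 0` iff `μ` is one of the
  four, `j(W_μ) = 1728` iff `μ` is one of the six (`HessePencilHarmonicMembers` + §1, §2).

NOT here: the automorphisms of order `6` / `4` themselves (a statement about the group law), the
orbit `{1, ω, ω², ∞}` of the singular members beyond `HessePencilTriangles`
(`μ³ = 1 ↔ μ ∈ {1, ω, ω²}`),
and the real picture of B–M Figure 11.

## References

* [BonifantMilnor2018] A. Bonifant, J. Milnor, *On real and complex cubic curves*, Enseign. Math.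
  63 (2017) 21–61, §3 (eq. (14), Figure 11, Theorem 3.12 and its proof).
* [ArtebaniDolgachev2009] M. Artebani, I. Dolgachev, *The Hesse pencil of plane cubic curves*,
  Enseign. Math. (2) 55 (2009) 235–273, §2 (the binary forms `A`, `B`), §4 (orbits `12, 6, 4, 4`;
  the invariant `Φ₁₈`).
* [SilvermanAEC2009] J. H. Silverman, *The Arithmetic of Elliptic Curves*, III §1 (`j = 0`,
  `j = 1728`).
-/

open MvPolynomial

namespace Literature.AlgebraicGeometry.PlaneCurves

universe u

/-- Bonifant–Milnor's `64·J(𝒞(k)) = k³(k³ + 8)³/(k³ − 1)³` (local notation, no definition). -/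
local notation3 "𝐣[" k "]" => (k ^ 3 * (k ^ 3 + 8) ^ 3 / (k ^ 3 - 1) ^ 3)

/-- The Hesse cubic `H_μ = X³ + Y³ + Z³ − 3μXYZ` (local notation, no definition). -/
local notation3 "𝐇[" μ "]" =>
  (X 0 ^ 3 + X 1 ^ 3 + X 2 ^ 3 - C (3 * μ) * (X 0 * X 1 * X 2) : MvPolynomial (Fin 3) _)

/-- `Φ₁₈ = (x³ + y³ + z³)⁶ − 540x³y³z³(x³ + y³ + z³)³ − 5832x⁶y⁶z⁶` (local notation, no
definition; as in `HessePencilInvariants`). -/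
local notation3 "Φ₁₈" => ((X 0 ^ 3 + X 1 ^ 3 + X 2 ^ 3) ^ 6 -
  540 * (X 0 * X 1 * X 2) ^ 3 * (X 0 ^ 3 + X 1 ^ 3 + X 2 ^ 3) ^ 3 -
  5832 * (X 0 * X 1 * X 2) ^ 6 : MvPolynomial (Fin 3) _)

/-- The Weierstrass model `W_μ = ⟨−μ, −μ², (μ³−1)/3, μ(μ³−1)/3, −(μ³−1)²/27⟩` of `H_μ`
(`HessePencilWeierstrassForm`; local notation, no definition). -/
local notation3 "𝐖[" μ "]" =>
  ({ a₁ := -μ, a₂ := -μ ^ 2, a₃ := (μ ^ 3 - 1) / 3, a₄ := μ * (μ ^ 3 - 1) / 3,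
     a₆ := -(μ ^ 3 - 1) ^ 2 / 27 } : WeierstrassCurve _)

section SpecialOrbits

variable {K : Type u} [Field K]

/-! ## §0 Plumbing -/

/-- `2·3 = 6 ≠ 0`. [folklore] -/
private theorem six_ne_zero' (h2 : (2 : K) ≠ 0) (h3 : (3 : K) ≠ 0) : (6 : K) ≠ 0 := by
  rw [show (6 : K) = 2 * 3 by norm_num]
  exact mul_ne_zero h2 h3

/-- **"each counted twice"**: `k³(k³ + 8)³ − 64(k³ − 1)³ = (k⁶ − 20k³ − 8)²` — the level set
`J = 1` of the degree-twelve function `J` is the harmonic sextic, doubled. [cite: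
BonifantMilnor2018, §3, Theorem 3.12 (proof: "each counted twice since `1 + √3` is a fixed point
of `η`")] -/
theorem hesseJ_numerator_sub_sixty_four (k : K) :
    k ^ 3 * (k ^ 3 + 8) ^ 3 - 64 * (k ^ 3 - 1) ^ 3 = (k ^ 6 - 20 * k ^ 3 - 8) ^ 2 := by
  ring

/-! ## §1 The four equianharmonic parameters `0, −2, −2ω, −2ω²` (`J = 0`) -/

/-- **`J = 0` iff equianharmonic**: for a smooth parameter (`k³ ≠ 1`),
`k³(k³ + 8)³/(k³ − 1)³ = 0 ↔ k(k³ + 8) = 0`. [cite: BonifantMilnor2018, §3, eq. (14) and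
Figure 11 ("for `J = 0` we have `k = 0` or `k = −2`")] [cite: ArtebaniDolgachev2009, §2 (the
binary form `A(t₀, t₁) = 12u₁(u₀³ − u₁³)`: equianharmonic cubics)] -/
theorem hesseJ_eq_zero_iff {k : K} (hk : k ^ 3 ≠ 1) : 𝐣[k] = 0 ↔ k * (k ^ 3 + 8) = 0 := by
  have hD : (k ^ 3 - 1) ^ 3 ≠ 0 := pow_ne_zero 3 (sub_ne_zero.2 hk)
  rw [div_eq_zero_iff, or_iff_left hD, mul_eq_zero, mul_eq_zero,
    pow_eq_zero_iff (by norm_num : (3 : ℕ) ≠ 0), pow_eq_zero_iff (by norm_num : (3 : ℕ) ≠ 0)]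

/-- **The four equianharmonic parameters**: with `ω² + ω + 1 = 0`,
`k(k³ + 8) = 0 ↔ k ∈ {0, −2, −2ω, −2ω²}` (i.e. `λ = −3k ∈ {0, 6, 6ε, 6ε²}`; B–M over `ℝ`: "for
`J = 0` we have `k = 0` or `k = −2`").  [cite: ArtebaniDolgachev2009, §2 (the zeroes of `A`;
"For example, the Fermat curve `E₀` is one of them"), §4 (the four equianharmonic members)]
[cite: BonifantMilnor2018, §3, Figure 11] -/
theorem hesse_equianharmonic_iff {ω : K} (hω : ω ^ 2 + ω + 1 = 0) (k : K) :
    k * (k ^ 3 + 8) = 0 ↔ k = 0 ∨ k = -2 ∨ k = -2 * ω ∨ k = -2 * ω ^ 2 := by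
  rw [equianharmonic_parameters hω, mul_eq_zero, mul_eq_zero, mul_eq_zero]
  constructor
  · rintro (((h | h) | h) | h)
    · exact Or.inl h
    · exact Or.inr (Or.inl (by linear_combination h))
    · exact Or.inr (Or.inr (Or.inl (by linear_combination h)))
    · exact Or.inr (Or.inr (Or.inr (by linear_combination h)))
  · rintro (h | h | h | h)
    · exact Or.inl (Or.inl (Or.inl h))
    · exact Or.inl (Or.inl (Or.inr (by linear_combination h)))
    · exact Or.inl (Or.inr (by linear_combination h))
    · exact Or.inr (by linear_combination h)

/-- The four equianharmonic parameters as a set: `{k | k(k³ + 8) = 0} = {0, −2, −2ω, −2ω²}`.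
[cite: ArtebaniDolgachev2009, §2, §4 (the four equianharmonic members)] -/
theorem hesse_equianharmonic_set_eq {ω : K} (hω : ω ^ 2 + ω + 1 = 0) :
    {k : K | k * (k ^ 3 + 8) = 0} = {0, -2, -2 * ω, -2 * ω ^ 2} := by
  ext k
  simp only [Set.mem_setOf_eq, Set.mem_insert_iff, Set.mem_singleton_iff,
    hesse_equianharmonic_iff hω]

/-- **The equianharmonic members are smooth** (`3 ≠ 0`): `k(k³ + 8) = 0 ⇒ k³ ≠ 1` (`k³ ∈ {0, −8}`
and `−8 = 1` forces `9 = 0`). [cite: ArtebaniDolgachev2009, §2 (the zeroes of `A` vs. the zeroes of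
`Δ = 4A³ + 27B²`)] -/
theorem hesse_equianharmonic_pow_three_ne_one (h3 : (3 : K) ≠ 0) {k : K}
    (hk : k * (k ^ 3 + 8) = 0) : k ^ 3 ≠ 1 := by
  intro h1
  rcases mul_eq_zero.1 hk with h0 | h8
  · rw [h0] at h1
    norm_num at h1
  · apply mul_ne_zero h3 h3
    linear_combination h8 - h1

/-- **Exactly four**: for `2 ≠ 0`, `3 ≠ 0`, `ω² + ω + 1 = 0` the four printed parameters
`0, −2, −2ω, −2ω²` are pairwise distinct. [cite: ArtebaniDolgachev2009, §4 ("orbits of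
cardinalities `12, 6, 4, 4`"; "the four equianharmonic members of the pencil")] -/
theorem hesse_equianharmonic_nodup (h2 : (2 : K) ≠ 0) (h3 : (3 : K) ≠ 0) {ω : K}
    (hω : ω ^ 2 + ω + 1 = 0) : ([0, -2, -2 * ω, -2 * ω ^ 2] : List K).Nodup := by
  have h6 := six_ne_zero' h2 h3
  simp only [List.nodup_cons, List.mem_cons, List.not_mem_nil, or_false, not_or, List.nodup_nil,
    and_true, not_false_eq_true]
  refine ⟨⟨?_, ?_, ?_⟩, ⟨?_, ?_⟩, ?_⟩
  · -- `0 = -2`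
    intro h
    exact h2 (by linear_combination h)
  · -- `0 = -2 * ω`
    intro h
    exact h2 (by linear_combination (-(ω) - 1) * h + (2) * hω)
  · -- `0 = -2 * ω ^ 2`
    intro h
    exact h2 (by linear_combination (ω) * h + (-2 * ω + 2) * hω)
  · -- `-2 = -2 * ω`
    intro h
    exact h6 (by linear_combination (-(ω) - 2) * h + (2) * hω)
  · -- `-2 = -2 * ω ^ 2`
    intro h
    exact h6 (by linear_combination (ω - 1) * h + (-2 * ω + 4) * hω)
  · -- `-2 * ω = -2 * ω ^ 2`
    intro h
    exact h6 (by linear_combination (2 * ω + 1) * h + (-4 * ω + 6) * hω)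

/-- **An orbit of cardinality `4`**: for `2 ≠ 0`, `3 ≠ 0`, `ω² + ω + 1 = 0` there are exactly four
equianharmonic parameters. [cite: ArtebaniDolgachev2009, §4 ("orbits of cardinalities
`12, 6, 4, 4`")] -/
theorem hesse_equianharmonic_ncard (h2 : (2 : K) ≠ 0) (h3 : (3 : K) ≠ 0) {ω : K}
    (hω : ω ^ 2 + ω + 1 = 0) : {k : K | k * (k ^ 3 + 8) = 0}.ncard = 4 := by
  classical
  have hS : {k : K | k * (k ^ 3 + 8) = 0} = ↑([0, -2, -2 * ω, -2 * ω ^ 2] : List K).toFinset := by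
    ext k
    rw [Set.mem_setOf_eq, hesse_equianharmonic_iff hω, List.coe_toFinset, Set.mem_setOf_eq]
    simp only [List.mem_cons, List.not_mem_nil, or_false]
  rw [hS, Set.ncard_coe_finset, List.toFinset_card_of_nodup (hesse_equianharmonic_nodup h2 h3 hω)]
  rfl

/-- **The fibre `J = 0`**: for `3 ≠ 0` and `ω² + ω + 1 = 0`, the smooth parameters with `J = 0`
are exactly `0, −2, −2ω, −2ω²` ("for `J = 0` we have `k = 0` or `k = −2`" over `ℝ`).
[cite: BonifantMilnor2018, §3, eq. (14), Figure 11] [cite: ArtebaniDolgachev2009, §2, §4] -/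
theorem hesseJ_fibre_zero_eq (h3 : (3 : K) ≠ 0) {ω : K} (hω : ω ^ 2 + ω + 1 = 0) :
    {l : K | l ^ 3 ≠ 1 ∧ 𝐣[l] = 0} = {0, -2, -2 * ω, -2 * ω ^ 2} := by
  rw [← hesse_equianharmonic_set_eq hω]
  ext l
  simp only [Set.mem_setOf_eq]
  constructor
  · rintro ⟨hl, hJ⟩
    exact (hesseJ_eq_zero_iff hl).1 hJ
  · intro hl
    have hl3 := hesse_equianharmonic_pow_three_ne_one h3 hl
    exact ⟨hl3, (hesseJ_eq_zero_iff hl3).2 hl⟩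

/-- **The fibre `J = 0` has exactly four points** (`2 ≠ 0`, `3 ≠ 0`, `ω ∈ K`).
[cite: ArtebaniDolgachev2009, §4 ("orbits of cardinalities `12, 6, 4, 4`")]
[cite: BonifantMilnor2018, §3, Theorem 3.12] -/
theorem hesseJ_fibre_zero_ncard (h2 : (2 : K) ≠ 0) (h3 : (3 : K) ≠ 0) {ω : K}
    (hω : ω ^ 2 + ω + 1 = 0) : {l : K | l ^ 3 ≠ 1 ∧ 𝐣[l] = 0}.ncard = 4 := by
  rw [hesseJ_fibre_zero_eq h3 hω, ← hesse_equianharmonic_set_eq hω]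
  exact hesse_equianharmonic_ncard h2 h3 hω

/-! ## §2 The six harmonic parameters `ω^b(1 ± √3)` (`J = 1`) -/

/-- **`J = 1` iff harmonic**: for a smooth parameter (`k³ ≠ 1`),
`k³(k³ + 8)³/(k³ − 1)³ = 64 ↔ k⁶ − 20k³ − 8 = 0` (the level set `J = 1` is the harmonic sextic
"counted twice", `hesseJ_numerator_sub_sixty_four`). [cite: BonifantMilnor2018, §3, eq. (14),
Figure 11 ("for `J = 1` we have `k = 1 ± √3`"), Theorem 3.12 (proof)]
[cite: ArtebaniDolgachev2009, §2 (the binary form `B(t₀, t₁) = 2(u₀⁶ − 20u₀³u₁³ − 8u₁⁶)`: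
harmonic cubics)] -/
theorem hesseJ_eq_sixty_four_iff {k : K} (hk : k ^ 3 ≠ 1) :
    𝐣[k] = 64 ↔ k ^ 6 - 20 * k ^ 3 - 8 = 0 := by
  have hD : (k ^ 3 - 1) ^ 3 ≠ 0 := pow_ne_zero 3 (sub_ne_zero.2 hk)
  rw [div_eq_iff hD]
  constructor
  · intro h
    have h' : (k ^ 6 - 20 * k ^ 3 - 8) ^ 2 = 0 := by linear_combination h
    exact (pow_eq_zero_iff two_ne_zero).1 h'
  · intro h
    linear_combination (k ^ 6 - 20 * k ^ 3 - 8) * h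

/-- The harmonic sextic in six linear factors, homogeneous version over any commutative ring with
`w² + w + 1 = 0` and `σ² = 3`: `S⁶ − 20S³c³ − 8c⁶ = ∏_{b, ±} (S − w^b(1 ± σ)c)`. [folklore] -/
private theorem harmonic_prod_six_hom {R : Type*} [CommRing R] {w σ : R} (hw : w ^ 2 + w + 1 = 0)
    (hσ : σ ^ 2 = 3) (S c : R) :
    S ^ 6 - 20 * S ^ 3 * c ^ 3 - 8 * c ^ 6 =
      (S - (1 + σ) * c) * (S - (1 - σ) * c) * (S - w * (1 + σ) * c) * (S - w * (1 - σ) * c) *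
        (S - w ^ 2 * (1 + σ) * c) * (S - w ^ 2 * (1 - σ) * c) := by
  linear_combination (2 * S ^ 5 * c + 2 * S ^ 4 * c ^ 2 * w ^ 2 - 6 * S ^ 4 * c ^ 2 * w + 2 * S
    ^ 4 * c ^ 2 - 4 * S ^ 3 * c ^ 3 * w ^ 3 - 4 * S ^ 3 * c ^ 3 * w ^ 2 + 16 * S ^ 3 * c ^ 3 * w
    - 20 * S ^ 3 * c ^ 3 - 4 * S ^ 2 * c ^ 4 * w ^ 4 + 12 * S ^ 2 * c ^ 4 * w ^ 3 - 4 * S ^ 2 *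
    c ^ 4 * w ^ 2 + 8 * S * c ^ 5 * w ^ 4 + 8 * c ^ 6 * w ^ 4 - 8 * c ^ 6 * w ^ 3 + 8 * c ^ 6 *
    w - 8 * c ^ 6) * hw + (S ^ 4 * c ^ 2 * w ^ 4 + S ^ 4 * c ^ 2 * w ^ 2 + S ^ 4 * c ^ 2 - 2 * S
    ^ 3 * c ^ 3 * w ^ 5 - 4 * S ^ 3 * c ^ 3 * w ^ 4 - 4 * S ^ 3 * c ^ 3 * w ^ 2 - 2 * S ^ 3 * c
    ^ 3 * w - (S ^ 2 * c ^ 4 * w ^ 6 * σ ^ 2) - (S ^ 2 * c ^ 4 * w ^ 6) + 4 * S ^ 2 * c ^ 4 * w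
    ^ 5 - (S ^ 2 * c ^ 4 * w ^ 4 * σ ^ 2) + 3 * S ^ 2 * c ^ 4 * w ^ 4 + 4 * S ^ 2 * c ^ 4 * w ^
    3 - (S ^ 2 * c ^ 4 * w ^ 2 * σ ^ 2) - (S ^ 2 * c ^ 4 * w ^ 2) + 2 * S * c ^ 5 * w ^ 6 * σ ^
    2 + 2 * S * c ^ 5 * w ^ 6 + 2 * S * c ^ 5 * w ^ 5 * σ ^ 2 + 2 * S * c ^ 5 * w ^ 5 + 2 * S *
    c ^ 5 * w ^ 4 * σ ^ 2 + 2 * S * c ^ 5 * w ^ 4 + c ^ 6 * w ^ 6 * σ ^ 4 + 3 * c ^ 6 * w ^ 6) *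
    hσ

/-- **The six harmonic parameters, as a factorisation**: with `ω² + ω + 1 = 0` and `s² = 3`,
`k⁶ − 20k³ − 8 = (k − (1+s))(k − (1−s))(k − ω(1+s))(k − ω(1−s))(k − ω²(1+s))(k − ω²(1−s))`.
[cite: BonifantMilnor2018, §3, Theorem 3.12 (proof: "the orbit of `1 + √3` consists of the
following six points … `1 + √3, (1 + √3)γ, (1 + √3)γ̄, 1 − √3, (1 − √3)γ, (1 − √3)γ̄`")]
[cite: ArtebaniDolgachev2009, §2 (the zeroes of `B`)] -/
theorem hesse_harmonic_eq_prod_six {ω : K} (hω : ω ^ 2 + ω + 1 = 0) {s : K} (hs : s ^ 2 = 3)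
    (k : K) :
    k ^ 6 - 20 * k ^ 3 - 8 =
      (k - (1 + s)) * (k - (1 - s)) * (k - ω * (1 + s)) * (k - ω * (1 - s)) *
        (k - ω ^ 2 * (1 + s)) * (k - ω ^ 2 * (1 - s)) := by
  have h := harmonic_prod_six_hom hω hs k 1
  simp only [mul_one, one_pow] at h
  exact h

/-- **The six harmonic parameters**: with `ω² + ω + 1 = 0` and `s² = 3`,
`k⁶ − 20k³ − 8 = 0 ↔ k ∈ {1 + s, 1 − s, ω(1 + s), ω(1 − s), ω²(1 + s), ω²(1 − s)}` ("for `J = 1`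
we have `k = 1 ± √3`" over `ℝ`). [cite: BonifantMilnor2018, §3, Figure 11, Theorem 3.12 (proof)]
[cite: ArtebaniDolgachev2009, §2 (harmonic cubics), §4 (the six harmonic cubics)] -/
theorem hesse_harmonic_iff {ω : K} (hω : ω ^ 2 + ω + 1 = 0) {s : K} (hs : s ^ 2 = 3) (k : K) :
    k ^ 6 - 20 * k ^ 3 - 8 = 0 ↔
      k = 1 + s ∨ k = 1 - s ∨ k = ω * (1 + s) ∨ k = ω * (1 - s) ∨ k = ω ^ 2 * (1 + s) ∨
        k = ω ^ 2 * (1 - s) := by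
  rw [hesse_harmonic_eq_prod_six hω hs k, mul_eq_zero, mul_eq_zero, mul_eq_zero, mul_eq_zero,
    mul_eq_zero, sub_eq_zero, sub_eq_zero, sub_eq_zero, sub_eq_zero, sub_eq_zero, sub_eq_zero]
  simp only [or_assoc]

/-- The six harmonic parameters as a set. [cite: BonifantMilnor2018, §3, Theorem 3.12 (proof)]
[cite: ArtebaniDolgachev2009, §4 (the six harmonic cubics)] -/
theorem hesse_harmonic_set_eq {ω : K} (hω : ω ^ 2 + ω + 1 = 0) {s : K} (hs : s ^ 2 = 3) :
    {k : K | k ^ 6 - 20 * k ^ 3 - 8 = 0} =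
      {1 + s, 1 - s, ω * (1 + s), ω * (1 - s), ω ^ 2 * (1 + s), ω ^ 2 * (1 - s)} := by
  ext k
  simp only [Set.mem_setOf_eq, Set.mem_insert_iff, Set.mem_singleton_iff, hesse_harmonic_iff hω hs]

/-- **The harmonic members are smooth** (`3 ≠ 0`): `k⁶ − 20k³ − 8 = 0 ⇒ k³ ≠ 1` (`k³ = 1` would
give `−27 = 0`). [cite: ArtebaniDolgachev2009, §2 (the zeroes of `B` vs. the zeroes of `Δ`)] -/
theorem hesse_harmonic_pow_three_ne_one (h3 : (3 : K) ≠ 0) {k : K}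
    (hk : k ^ 6 - 20 * k ^ 3 - 8 = 0) : k ^ 3 ≠ 1 := by
  intro h1
  apply mul_ne_zero (mul_ne_zero h3 h3) h3
  linear_combination (k ^ 3 - 19) * h1 - hk

/-- **"`k = 1 ± √3` yields `J = 1`"**, the parameter form: `1 + s` is harmonic whenever `s² = 3`
(both signs: replace `s` by `−s`). [cite: BonifantMilnor2018, §3 (after eq. (14)); Figure 11] -/
theorem hesse_one_add_sqrt_three_harmonic {s : K} (hs : s ^ 2 = 3) :
    (1 + s) ^ 6 - 20 * (1 + s) ^ 3 - 8 = 0 := by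
  linear_combination (s ^ 4 + 6 * s ^ 3 + 18 * s ^ 2 + 18 * s + 9) * hs

/-- **Exactly six** ("the following six points"): for `2 ≠ 0`, `3 ≠ 0`, `ω² + ω + 1 = 0`,
`s² = 3` the six printed parameters `1 + s, 1 − s, ω(1 + s), ω(1 − s), ω²(1 + s), ω²(1 − s)` are
pairwise distinct. [cite: BonifantMilnor2018, §3, Theorem 3.12 (proof)]
[cite: ArtebaniDolgachev2009, §4 ("orbits of cardinalities `12, 6, 4, 4`"; "the six harmonic
cubics in the pencil")] -/
theorem hesse_harmonic_nodup (h2 : (2 : K) ≠ 0) (h3 : (3 : K) ≠ 0) {ω : K}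
    (hω : ω ^ 2 + ω + 1 = 0) {s : K} (hs : s ^ 2 = 3) :
    ([1 + s, 1 - s, ω * (1 + s), ω * (1 - s), ω ^ 2 * (1 + s), ω ^ 2 * (1 - s)] :
      List K).Nodup := by
  have h6 := six_ne_zero' h2 h3
  simp only [List.nodup_cons, List.mem_cons, List.not_mem_nil, or_false, not_or, List.nodup_nil,
    and_true, not_false_eq_true]
  refine ⟨⟨?_, ?_, ?_, ?_, ?_⟩, ⟨?_, ?_, ?_, ?_⟩, ⟨?_, ?_, ?_⟩, ⟨?_, ?_⟩, ?_⟩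
  · -- `1 + s = 1 - s`
    intro h
    exact h6 (by linear_combination (s) * h + (-2) * hs)
  · -- `1 + s = ω * (1 + s)`
    intro h
    exact h6 (by
      linear_combination (ω * s - (ω) + 2 * s - 2) * h + (2) * hω + (ω ^ 2 + ω - 2) * hs)
  · -- `1 + s = ω * (1 - s)`
    intro h
    exact h6 (by linear_combination (-(ω * s) + ω + 2) * h + (-2 * s + 4) * hω + (ω ^ 2 + ω) * hs)
  · -- `1 + s = ω ^ 2 * (1 + s)`
    intro h
    exact h6 (by
      linear_combination (-(ω * s) + ω + s - 1) * h + (-2 * ω + 4) * hω + (-(ω ^ 3) + ω ^ 2 + ω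
        - 1) * hs)
  · -- `1 + s = ω ^ 2 * (1 - s)`
    intro h
    exact h6 (by
      linear_combination (ω * s - (ω) + s + 1) * h + (2 * ω * s - 4 * ω - 2 * s + 2) * hω + (-(ω
        ^ 3) - (ω ^ 2) - (ω) - 1) * hs)
  · -- `1 - s = ω * (1 + s)`
    intro h
    exact h6 (by linear_combination (ω * s + ω + 2) * h + (2 * s + 4) * hω + (ω ^ 2 + ω) * hs)
  · -- `1 - s = ω * (1 - s)`
    intro h
    exact h6 (by
      linear_combination (-(ω * s) - (ω) - 2 * s - 2) * h + (2) * hω + (ω ^ 2 + ω - 2) * hs)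
  · -- `1 - s = ω ^ 2 * (1 + s)`
    intro h
    exact h6 (by
      linear_combination (-(ω * s) - (ω) - (s) + 1) * h + (-2 * ω * s - 4 * ω + 2 * s + 2) * hω
        + (-(ω ^ 3) - (ω ^ 2) - (ω) - 1) * hs)
  · -- `1 - s = ω ^ 2 * (1 - s)`
    intro h
    exact h6 (by
      linear_combination (ω * s + ω - (s) - 1) * h + (-2 * ω + 4) * hω + (-(ω ^ 3) + ω ^ 2 + ω -
        1) * hs)
  · -- `ω * (1 + s) = ω * (1 - s)`
    intro h
    exact h6 (by linear_combination (-(ω * s) - (s)) * h + (6) * hω + (2 * ω ^ 2 + 2 * ω) * hs)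
  · -- `ω * (1 + s) = ω ^ 2 * (1 + s)`
    intro h
    exact h6 (by
      linear_combination (-2 * ω * s + 2 * ω - (s) + 1) * h + (-4 * ω + 6) * hω + (-2 * ω ^ 3 +
        ω ^ 2 + ω) * hs)
  · -- `ω * (1 + s) = ω ^ 2 * (1 - s)`
    intro h
    exact h6 (by
      linear_combination (-2 * ω - (s) - 1) * h + (2 * ω * s - 2 * ω + 6) * hω + (ω ^ 2 + ω) *
        hs)
  · -- `ω * (1 - s) = ω ^ 2 * (1 + s)`
    intro h
    exact h6 (by
      linear_combination (-2 * ω + s - 1) * h + (-2 * ω * s - 2 * ω + 6) * hω + (ω ^ 2 + ω) * hs)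
  · -- `ω * (1 - s) = ω ^ 2 * (1 - s)`
    intro h
    exact h6 (by
      linear_combination (2 * ω * s + 2 * ω + s + 1) * h + (-4 * ω + 6) * hω + (-2 * ω ^ 3 + ω ^
        2 + ω) * hs)
  · -- `ω ^ 2 * (1 + s) = ω ^ 2 * (1 - s)`
    intro h
    exact h6 (by linear_combination (ω * s) * h + (-6 * ω + 6) * hω + (-2 * ω ^ 3) * hs)

/-- **An orbit of cardinality `6`**: for `2 ≠ 0`, `3 ≠ 0`, `ω² + ω + 1 = 0`, `s² = 3` there are
exactly six harmonic parameters. [cite: ArtebaniDolgachev2009, §4 ("orbits of cardinalities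
`12, 6, 4, 4`")] [cite: BonifantMilnor2018, §3, Theorem 3.12 (proof)] -/
theorem hesse_harmonic_ncard (h2 : (2 : K) ≠ 0) (h3 : (3 : K) ≠ 0) {ω : K}
    (hω : ω ^ 2 + ω + 1 = 0) {s : K} (hs : s ^ 2 = 3) :
    {k : K | k ^ 6 - 20 * k ^ 3 - 8 = 0}.ncard = 6 := by
  classical
  have hS : {k : K | k ^ 6 - 20 * k ^ 3 - 8 = 0} =
      ↑([1 + s, 1 - s, ω * (1 + s), ω * (1 - s), ω ^ 2 * (1 + s), ω ^ 2 * (1 - s)] :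
        List K).toFinset := by
    ext k
    rw [Set.mem_setOf_eq, hesse_harmonic_iff hω hs, List.coe_toFinset, Set.mem_setOf_eq]
    simp only [List.mem_cons, List.not_mem_nil, or_false]
  rw [hS, Set.ncard_coe_finset, List.toFinset_card_of_nodup (hesse_harmonic_nodup h2 h3 hω hs)]
  rfl

/-- **The fibre `J = 1`**: for `3 ≠ 0`, `ω² + ω + 1 = 0`, `s² = 3`, the smooth parameters with
`J = 1` (`𝐣 = 64`) are exactly the six printed points. [cite: BonifantMilnor2018, §3, Figure 11
("for `J = 1` we have `k = 1 ± √3`"), Theorem 3.12 (proof)] -/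
theorem hesseJ_fibre_sixty_four_eq (h3 : (3 : K) ≠ 0) {ω : K} (hω : ω ^ 2 + ω + 1 = 0) {s : K}
    (hs : s ^ 2 = 3) :
    {l : K | l ^ 3 ≠ 1 ∧ 𝐣[l] = 64} =
      {1 + s, 1 - s, ω * (1 + s), ω * (1 - s), ω ^ 2 * (1 + s), ω ^ 2 * (1 - s)} := by
  rw [← hesse_harmonic_set_eq hω hs]
  ext l
  simp only [Set.mem_setOf_eq]
  constructor
  · rintro ⟨hl, hJ⟩
    exact (hesseJ_eq_sixty_four_iff hl).1 hJ
  · intro hl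
    have hl3 := hesse_harmonic_pow_three_ne_one h3 hl
    exact ⟨hl3, (hesseJ_eq_sixty_four_iff hl3).2 hl⟩

/-- **The fibre `J = 1` has exactly six points** (`2 ≠ 0`, `3 ≠ 0`, `ω, √3 ∈ K`).
[cite: ArtebaniDolgachev2009, §4 ("orbits of cardinalities `12, 6, 4, 4`")]
[cite: BonifantMilnor2018, §3, Theorem 3.12 (proof)] -/
theorem hesseJ_fibre_sixty_four_ncard (h2 : (2 : K) ≠ 0) (h3 : (3 : K) ≠ 0) {ω : K}
    (hω : ω ^ 2 + ω + 1 = 0) {s : K} (hs : s ^ 2 = 3) :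
    {l : K | l ^ 3 ≠ 1 ∧ 𝐣[l] = 64}.ncard = 6 := by
  rw [hesseJ_fibre_sixty_four_eq h3 hω hs, ← hesse_harmonic_set_eq hω hs]
  exact hesse_harmonic_ncard h2 h3 hω hs

/-- **"the orbit of `1 + √3` consists of the following six points"** (B–M, proof of Theorem 3.12),
as a statement about `J`: for `3 ≠ 0`, `ω² + ω + 1 = 0`, `s² = 3`, the smooth parameters `l` with
`J(l) = J(1 + s)` are exactly `1 + s, (1 + s)ω, (1 + s)ω², 1 − s, (1 − s)ω, (1 − s)ω²` (and
`J(1 + s) = 1`, i.e. `𝐣[1 + s] = 64`, `HessePencilTetrahedralOrbits.hesseJ_one_add_sqrt_three`).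
[cite: BonifantMilnor2018, §3, Theorem 3.12 (proof) and footnote 10] -/
theorem hesseJ_fibre_one_add_sqrt_three (h3 : (3 : K) ≠ 0) {ω : K} (hω : ω ^ 2 + ω + 1 = 0)
    {s : K} (hs : s ^ 2 = 3) :
    {l : K | l ^ 3 ≠ 1 ∧ 𝐣[l] = 𝐣[1 + s]} =
      {1 + s, (1 + s) * ω, (1 + s) * ω ^ 2, 1 - s, (1 - s) * ω, (1 - s) * ω ^ 2} := by
  have hh := hesse_one_add_sqrt_three_harmonic hs
  have hJ : 𝐣[1 + s] = 64 :=
    (hesseJ_eq_sixty_four_iff (hesse_harmonic_pow_three_ne_one h3 hh)).2 hh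
  rw [hJ, hesseJ_fibre_sixty_four_eq h3 hω hs]
  ext l
  simp only [Set.mem_insert_iff, Set.mem_singleton_iff, mul_comm (1 + s), mul_comm (1 - s)]
  tauto

/-! ## §3 `Φ₁₈` is the product of the six harmonic members -/

/-- `C ω² + C ω + 1 = 0` in `K[X, Y, Z]`. [folklore] -/
private theorem C_omega_rel'' {ω : K} (hω : ω ^ 2 + ω + 1 = 0) :
    (C ω : MvPolynomial (Fin 3) K) ^ 2 + C ω + 1 = 0 := by
  have h := congrArg (C : K → MvPolynomial (Fin 3) K) hω
  simpa using h

/-- `(C s)² = 3` in `K[X, Y, Z]`. [folklore] -/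
private theorem C_sqrt_three_rel {s : K} (hs : s ^ 2 = 3) :
    (C s : MvPolynomial (Fin 3) K) ^ 2 = 3 := by
  have h := congrArg (C : K → MvPolynomial (Fin 3) K) hs
  rw [map_pow] at h
  rw [h]
  exact map_ofNat C 3

/-- **"The curve `Φ₁₈ = 0` is the union of the six harmonic cubics in the pencil"**, as an
identity of forms: with `ω² + ω + 1 = 0` and `s² = 3`,
`Φ₁₈ = H_{1+s} · H_{1−s} · H_{ω(1+s)} · H_{ω(1−s)} · H_{ω²(1+s)} · H_{ω²(1−s)}` in `K[X, Y, Z]`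
(`Φ₁₈ = S⁶ − 20S³(3P)³ − 8(3P)⁶`, `S = X³ + Y³ + Z³`, `P = XYZ`, and §2).
[cite: ArtebaniDolgachev2009, §4 (the invariant `Φ₁₈`)] -/
theorem phi18_eq_prod {ω : K} (hω : ω ^ 2 + ω + 1 = 0) {s : K} (hs : s ^ 2 = 3) :
    (Φ₁₈ : MvPolynomial (Fin 3) K) =
      𝐇[1 + s] * 𝐇[1 - s] * 𝐇[ω * (1 + s)] * 𝐇[ω * (1 - s)] * 𝐇[ω ^ 2 * (1 + s)] *
        𝐇[ω ^ 2 * (1 - s)] := by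
  have key := harmonic_prod_six_hom (C_omega_rel'' hω) (C_sqrt_three_rel hs)
    (X 0 ^ 3 + X 1 ^ 3 + X 2 ^ 3 : MvPolynomial (Fin 3) K) (3 * (X 0 * X 1 * X 2))
  simp only [map_mul, map_add, map_sub, map_pow, map_one, map_ofNat]
  generalize (X 0 ^ 3 + X 1 ^ 3 + X 2 ^ 3 : MvPolynomial (Fin 3) K) = S at key ⊢
  generalize (X 0 * X 1 * X 2 : MvPolynomial (Fin 3) K) = P at key ⊢
  linear_combination key

/-! ## §4 Bridge to Mathlib's `j`-invariant -/

/-- **`j(W_μ) = 0` iff `μ ∈ {0, −2, −2ω, −2ω²}`** (`3 ≠ 0`, `μ³ ≠ 1`, `ω² + ω + 1 = 0`):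
`HessePencilHarmonicMembers.hesse_weierstrass_j_eq_zero_iff` made explicit.
[cite: ArtebaniDolgachev2009, §2 (equianharmonic cubics)] [cite: SilvermanAEC2009, III §1
(`j = 0` iff `A = 0`)] -/
theorem hesse_weierstrass_j_eq_zero_iff_mem (h3 : (3 : K) ≠ 0) {ω : K} (hω : ω ^ 2 + ω + 1 = 0)
    {μ : K} (hμ : μ ^ 3 ≠ 1) :
    haveI := (hesse_weierstrass_isElliptic_iff h3 μ).2 hμ
    (𝐖[μ] : WeierstrassCurve K).j = 0 ↔ μ ∈ ({0, -2, -2 * ω, -2 * ω ^ 2} : Set K) := by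
  rw [hesse_weierstrass_j_eq_zero_iff h3 hμ, ← hesse_equianharmonic_set_eq hω, Set.mem_setOf_eq]

/-- **`j(W_μ) = 1728` iff `μ ∈ {1 ± s, ω(1 ± s), ω²(1 ± s)}`** (`3 ≠ 0`, `μ³ ≠ 1`, `ω² + ω + 1 = 0`,
`s² = 3`): `HessePencilHarmonicMembers.hesse_weierstrass_j_eq_1728_iff` made explicit.
[cite: ArtebaniDolgachev2009, §2 (harmonic cubics)] [cite: BonifantMilnor2018, §3 ("`k = 1 ± √3`
yields `J = 1`")] [cite: SilvermanAEC2009, III §1 (`j = 1728` iff `B = 0`)] -/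
theorem hesse_weierstrass_j_eq_1728_iff_mem (h3 : (3 : K) ≠ 0) {ω : K} (hω : ω ^ 2 + ω + 1 = 0)
    {s : K} (hs : s ^ 2 = 3) {μ : K} (hμ : μ ^ 3 ≠ 1) :
    haveI := (hesse_weierstrass_isElliptic_iff h3 μ).2 hμ
    (𝐖[μ] : WeierstrassCurve K).j = 1728 ↔
      μ ∈ ({1 + s, 1 - s, ω * (1 + s), ω * (1 - s), ω ^ 2 * (1 + s), ω ^ 2 * (1 - s)} : Set K) := by
  rw [hesse_weierstrass_j_eq_1728_iff h3 hμ, ← hesse_harmonic_set_eq hω hs, Set.mem_setOf_eq]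

end SpecialOrbits

end Literature.AlgebraicGeometry.PlaneCurves
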